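import Summits.ResolutionOfSingularities.ResolutionOfSingularities.Theorems.PurelyInseparableDim4PiPlateauBrickData
import Summits.ResolutionOfSingularities.ResolutionOfSingularities.Theorems.PurelyInseparableDim4HasseEulerAlpha
import Summits.ResolutionOfSingularities.ResolutionOfSingularities.Theorems.Rescue.BedCylinderIdleChart
import HarnessLib

/-!
# Π, first half (J0⁺): the residual order does not rise on a `V_q`-active point blow-up (cell `res-dim4-pi`, I-5-5)

[OURS · counted 0 · instrument]  Nothing here is a statement about resolution of singularities in dimension ≥ 4 /
characteristic `p`, which is NOT proved.  This module assembles the bricks T1 (`…PiPlateauClasses`), T2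
(`…PiPlateauBrickData`), Step (α) (`HasseEuler.step_alpha_core`) and Step (β) (`HasseEuler.step_beta_core`) into
the FIRST conclusion of `Plateau.PiEdge` (res-dim4-idea-5 write-up `PiPlateau-consolidated.md` ecef900b4de1a97c
§2/§4, blueprint d8a3f498d0e42ada §D/§F):

* `exists_key` — **the key monomial**: for a `V_q`-witness `(A, i)` of a `q`-fold `F` (`q = p^e`), the class
  polynomial `G_{cls A}` has a monomial `x^k` inside the degree budget (`|k| + |r_T| + r_j ≤ |A_T| + A_j`) whose
  class monomial `x^{cls A} x^k` is NOT a `q`-th power (so it survives cleaning).  Proof: otherwise a low monomial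
  of `G_{cls A}` forces regime R (`q ∣ o`, `q ∣ A_u` on the untranslated `u ≠ j`) and hypothesis H of the bricks;
  then `i` translated ⇒ Step (α) gives `q ∣ A_i`, `i = j` ⇒ Step (β) gives `q ∣ A_j`, `i` untranslated ⇒ R gives
  `q ∣ A_i` — contradiction each time;
* `degree_budget` — the exponent bookkeeping `|cls A + k| + |r| ≤ o + |ρ|`;
* **`residualOrder_step_le`** — (J0⁺) `d′ ≤ d` on every MODE-0 edge from a `q`-fold `V_q`-active state with
  non-zero child (no cleanness needed), and the equality analysis `degree_eq_of_residualOrder_eq` used by Π.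

Typed and proved by res-dim4-typ-1.  Supports stmt-ResolutionOfSingularities-16155 (helper).
bears_on: LADDER-RESOLUTION:D157-DOOR2 (res-dim4-pi · I-5-5 Π · J0⁺).
-/

set_option linter.dupNamespace false -- mandated namespace of this single-conjunct summit

namespace Summit.ResolutionOfSingularities.ResolutionOfSingularities.Theorems.PIDim4

namespace Plateau

open MvPolynomial Finset
open Literature.AlgebraicGeometry.Resolution
open Literature.AlgebraicGeometry.Resolution.Hauser2010
open Literature.AlgebraicGeometry.Resolution.CentreBlowup
open Literature.Barriers.ResolutionOfSingularities
open Literature.Barriers.ResolutionOfSingularities.HauserPerlega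
open Summit.ResolutionOfSingularities.ResolutionOfSingularities.Theorems.Rescue.BedCylinderTransport
  (residualOrder_eq_ordZero_sub forall_le_degree_of_ordZero_eq)

variable {σ : Type*} {K : Type*} [Field K] [DecidableEq K]

/-! ## §1 Exponent arithmetic of class monomials `x^{cls A} · x^k` -/

/-- `t ≠ 0` on the support of `b_T`. [folklore] -/
theorem ne_zero_of_mem_support_tPart (t : σ → K) (b : σ →₀ ℕ) : ∀ m ∈ (tPart t b).support, t m ≠ 0 := by
  intro m hm h
  rw [Finsupp.mem_support_iff, tPart_apply, if_neg (not_not.mpr h)] at hm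
  exact hm rfl

/-- An exponent in the translated variables vanishes at the untranslated ones. [folklore] -/
theorem apply_eq_zero_of_uPart_eq_zero (t : σ → K) {k : σ →₀ ℕ} (hk : uPart t k = 0) {m : σ} (hm : t m = 0) :
    k m = 0 := by
  have := DFunLike.congr_fun hk m
  rwa [uPart_apply, if_pos hm, Finsupp.coe_zero, Pi.zero_apply] at this

variable [DecidableEq σ]

/-- `x^{cls A} x^k` at an untranslated variable. [folklore] -/
theorem cls_add_apply_of_eq_zero (q : ℕ) {j : σ} {t : σ → K} (A : σ →₀ ℕ) {k : σ →₀ ℕ}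
    (hk : uPart t k = 0) {m : σ} (hm : t m = 0) :
    (cls q j t A + k) m = if m = j then A.degree - q else A m := by
  rw [Finsupp.coe_add, Pi.add_apply, apply_eq_zero_of_uPart_eq_zero t hk hm, add_zero, cls_apply]
  by_cases hmj : m = j
  · rw [if_pos hmj, if_pos hmj]
  · rw [if_neg hmj, if_neg hmj, if_pos hm]

/-- `x^{cls A} x^k` at a translated variable. [folklore] -/
theorem cls_add_apply_of_ne_zero (q : ℕ) {j : σ} {t : σ → K} (ht : t j = 0) (A k : σ →₀ ℕ) {m : σ}
    (hm : t m ≠ 0) : (cls q j t A + k) m = k m := by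
  have hmj : m ≠ j := fun h => hm (h ▸ ht)
  rw [Finsupp.coe_add, Pi.add_apply, cls_apply, if_neg hmj, if_neg hm, zero_add]

/-- If `x^{cls A} x^k` is a `q`-th power then `x^k` is (`k` in the translated variables). [folklore] -/
theorem dvd_apply_of_isPth_cls_add (q : ℕ) {j : σ} {t : σ → K} (ht : t j = 0) (A : σ →₀ ℕ) {k : σ →₀ ℕ}
    (hk : uPart t k = 0) (h : IsPthPowerExponent q (cls q j t A + k)) : ∀ m, q ∣ k m := by
  intro m
  by_cases hm : t m = 0
  · rw [apply_eq_zero_of_uPart_eq_zero t hk hm]; exact dvd_zero q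
  · have := (isPthPowerExponent_iff q _).mp h m
    rwa [cls_add_apply_of_ne_zero q ht A k hm] at this

/-- If `x^{cls A} x^k` is a `q`-th power then `q ∣ |A| − q` and `q ∣ A_u` at every untranslated `u ≠ j`
(regime R). [folklore] -/
theorem dvd_of_isPth_cls_add (q : ℕ) {j : σ} {t : σ → K} (ht : t j = 0) (A : σ →₀ ℕ) {k : σ →₀ ℕ}
    (hk : uPart t k = 0) (h : IsPthPowerExponent q (cls q j t A + k)) :
    q ∣ A.degree - q ∧ ∀ u, t u = 0 → u ≠ j → q ∣ A u := by
  have h' := (isPthPowerExponent_iff q _).mp h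
  refine ⟨?_, fun u hu huj => ?_⟩
  · have := h' j
    rwa [cls_add_apply_of_eq_zero q A hk ht, if_pos rfl] at this
  · have := h' u
    rwa [cls_add_apply_of_eq_zero q A hk hu, if_neg huj] at this

variable [Fintype σ]

/-- Regime R sums up: `q ∣ |A_U| − A_j = Σ_{u ≠ j untranslated} A_u`. [folklore] -/
theorem dvd_degree_uPart_sub (q : ℕ) {j : σ} {t : σ → K} (ht : t j = 0) (A : σ →₀ ℕ)
    (h : ∀ u, t u = 0 → u ≠ j → q ∣ A u) : q ∣ (uPart t A).degree - A j := by
  have hsum : (uPart t A).degree = A j + ∑ m ∈ Finset.univ.erase j, uPart t A m := by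
    rw [Finsupp.degree_eq_sum, ← Finset.add_sum_erase _ _ (Finset.mem_univ j), uPart_apply, if_pos ht]
  rw [hsum, add_tsub_cancel_left]
  refine Finset.dvd_sum fun m hm => ?_
  rw [uPart_apply]
  split_ifs with htm
  · exact h m htm (Finset.ne_of_mem_erase hm)
  · exact dvd_zero q

/-- **The degree budget**: `|cls A + k| + |r| ≤ o + |ρ|` for `k` inside the budget. [folklore] -/
theorem degree_budget (q : ℕ) {j : σ} {t : σ → K} (ht : t j = 0) {o : ℕ} (hqo : q ≤ o) {A r : σ →₀ ℕ}
    (hrA : r ≤ A) (hAo : A.degree = o) {k : σ →₀ ℕ}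
    (hk : k.degree + (tPart t r).degree + r j ≤ (tPart t A).degree + A j) :
    (cls q j t A + k).degree + r.degree ≤ o + (rho q j t r o).degree := by
  have h1 := degree_cls_add q ht (hAo.symm ▸ hqo : q ≤ A.degree)
  have h2 := degree_eq_uPart_add_tPart t A
  have h3 := degree_eq_uPart_add_tPart t r
  have h4 := degree_rho_add q ht r o
  have h5 : r j ≤ A j := hrA j
  have h6 := apply_le_degree_uPart ht A
  rw [map_add]
  omega

/-! ## §2 The key monomial -/

/-- The class polynomial of an occurring class has a monomial inside the degree budget (its order is that of
`G̃ = translate t Q_A`, whose monomials all lie inside the budget). [folklore] -/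
theorem exists_mem_support_classPoly_degree_le (q : ℕ) {j : σ} {t : σ → K} (ht : t j = 0)
    {F : MvPolynomial σ K} (hq : ∀ b ∈ F.support, q ≤ b.degree) {r : σ →₀ ℕ}
    (hr : ∀ b ∈ F.support, r ≤ b) {A : σ →₀ ℕ} (hA : A ∈ F.support) :
    ∃ k ∈ (classPoly q j t F (cls q j t A)).support,
      k.degree + (tPart t r).degree + r j ≤ (tPart t A).degree + A j := by
  set Q := brickPoly q j t F r A with hQ
  have hQ0 : Q ≠ 0 := MvPolynomial.support_nonempty.mp ⟨_, mem_support_brickPoly q ht hq hr hA rfl⟩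
  have hT0 : PointBlowup.translate t Q ≠ 0 := PointBlowup.translate_ne_zero t hQ0
  obtain ⟨n, hn⟩ := exists_ordZero_eq_natCast hT0
  have hG : ordZero (classPoly q j t F (cls q j t A)) = n := by
    rw [classPoly_eq_translate_mul_brickPoly q j t F hr A, MohAlong.translate_mul,
      HasseEuler.ordZero_translate_monomial_mul t _ (ne_zero_of_mem_support_tPart t r), hn]
  obtain ⟨⟨k₀, hk₀, hk₀deg⟩, -⟩ := (ordZero_eq_nat_iff _ n).mp hG
  obtain ⟨⟨k₁, hk₁, hk₁deg⟩, -⟩ := (ordZero_eq_nat_iff _ n).mp hn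
  obtain ⟨β, hβ, hle⟩ :=
    PointBlowup.exists_le_of_mem_support_translate t Q (MvPolynomial.mem_support_iff.mpr hk₁)
  have h1 := degree_add_le_of_mem_support_brickPoly q ht hq hr hA hβ
  have h2 := Finsupp.degree_mono hle
  exact ⟨k₀, MvPolynomial.mem_support_iff.mpr hk₀, by omega⟩

/-- **THE KEY MONOMIAL.**  For a `V_q`-witness `(A, i)` (`A ∈ supp F`, `|A| = o = ord₀ F ≥ q = p^e`,
`r_i = 0`, `q ∤ A_i`; `x^r` divides every monomial of `F`): the class polynomial `G_{cls A}` has a monomial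
`x^k` inside the budget such that `x^{cls A} x^k` is not a `q`-th power.  (Step (α) / Step (β) / regime R.)
[folklore] -/
theorem exists_key (p : ℕ) [Fact p.Prime] [CharP K p] (e : ℕ) {j : σ} {t : σ → K} (ht : t j = 0)
    {F : MvPolynomial σ K} {o : ℕ} (hqo : p ^ e ≤ o) (hob : ∀ b ∈ F.support, o ≤ b.degree)
    {r : σ →₀ ℕ} (hr : ∀ b ∈ F.support, r ≤ b) {A : σ →₀ ℕ} (hA : A ∈ F.support) (hAo : A.degree = o)
    {i : σ} (hri : r i = 0) (hqi : ¬ p ^ e ∣ A i) :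
    ∃ k ∈ (classPoly (p ^ e) j t F (cls (p ^ e) j t A)).support,
      k.degree + (tPart t r).degree + r j ≤ (tPart t A).degree + A j ∧
        ¬ IsPthPowerExponent (p ^ e) (cls (p ^ e) j t A + k) := by
  set q := p ^ e with hqdef
  have hqb : ∀ b ∈ F.support, q ≤ b.degree := fun b hb => hqo.trans (hob b hb)
  set Q := brickPoly q j t F r A with hQdef
  have hG := classPoly_eq_translate_mul_brickPoly q j t F hr A
  have htT := ne_zero_of_mem_support_tPart t r
  have hrA : r ≤ A := hr A hA
  have hβA : tPart t A - tPart t r ∈ Q.support := mem_support_brickPoly q ht hqb hr hA rfl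
  have hTT : (tPart t A - tPart t r).degree + (tPart t r).degree = (tPart t A).degree := by
    rw [← map_add, tsub_add_cancel_of_le (tPart_mono t hrA)]
  by_contra H
  push Not at H
  -- a low monomial of `G_{cls A}` exists; it is a `q`-th power class monomial ⇒ regime R
  obtain ⟨k₀, hk₀, hk₀deg⟩ := exists_mem_support_classPoly_degree_le q ht hqb hr hA
  have hk₀u : uPart t k₀ = 0 := uPart_eq_zero_of_mem_support_classPoly q j t F hk₀
  obtain ⟨hRo, hRu⟩ := dvd_of_isPth_cls_add q ht A hk₀u (H k₀ hk₀ hk₀deg)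
  rw [hAo] at hRo
  have hqo' : q ∣ o := by
    obtain ⟨c, hc⟩ := hRo
    exact ⟨c + 1, by rw [Nat.mul_succ, ← hc]; omega⟩
  -- hypothesis H of the bricks for `P = G_{cls A} = translate t (x^{r_T} · Q_A)`
  have hP : PointBlowup.translate t (monomial (tPart t r) (1 : K) * ∑ β ∈ Q.support, monomial β (coeff β Q)) =
      classPoly q j t F (cls q j t A) := by
    rw [← brickPoly_eq_sum_support, ← hG]
  have hH : ∀ d ∈ (PointBlowup.translate t
      (monomial (tPart t r) (1 : K) * ∑ β ∈ Q.support, monomial β (coeff β Q))).support,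
      d.degree ≤ (tPart t A).degree + A j - r j - (tPart t r).degree → ∀ m, q ∣ d m := by
    intro d hd hddeg
    rw [hP] at hd
    have hdu := uPart_eq_zero_of_mem_support_classPoly q j t F hd
    exact dvd_apply_of_isPth_cls_add q ht A hdu (H d hd (by omega))
  have hdegQ : ∀ β ∈ Q.support, β.degree + (tPart t r).degree + r j ≤ (tPart t A).degree + A j :=
    fun β hβ => degree_add_le_of_mem_support_brickPoly q ht hqb hr hA hβ
  by_cases hti : t i = 0
  · by_cases hij : i = j
    · -- `i = j`: Step (β)
      subst hij
      have huA := degree_eq_uPart_add_tPart t A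
      have hiA := apply_le_degree_uPart ht A
      have hs : q ∣ (tPart t A).degree + A i - r i := by
        have h1 := dvd_degree_uPart_sub q ht A hRu
        have h2 : (tPart t A).degree + A i - r i = o - ((uPart t A).degree - A i) := by rw [hri]; omega
        rw [h2]
        exact Nat.dvd_sub hqo' h1
      have key := HasseEuler.step_beta_core p t (tPart t r) htT Q.support (fun β => coeff β Q)
        (coeff_ne_zero_of_mem_support_brickPoly q i t F r A) ((tPart t A).degree + A i - r i) hs
        (fun β hβ => by have := hdegQ β hβ; omega) hH
      have h1 := key _ hβA
      rw [hTT] at h1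
      apply hqi
      have h3 : A i = ((tPart t A).degree + A i - r i) - (tPart t A).degree := by rw [hri]; omega
      rw [h3]
      exact Nat.dvd_sub hs h1
    · -- `i` untranslated, `≠ j`: regime R
      exact hqi (hRu i hti hij)
  · -- `i` translated: Step (α)
    have hi' : tPart t r i = 0 := by rw [tPart_apply, if_pos hti, hri]
    have key := HasseEuler.step_alpha_core p t (tPart t r) htT hi' Q.support (fun β => coeff β Q)
      (coeff_ne_zero_of_mem_support_brickPoly q j t F r A)
      ((tPart t A).degree + A j - r j - (tPart t r).degree) (fun β hβ => by have := hdegQ β hβ; omega) hH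
    have h1 := key _ hβA
    rw [Finsupp.tsub_apply, tPart_apply, tPart_apply, if_pos hti, if_pos hti, hri, Nat.sub_zero] at h1
    exact hqi h1

/-! ## §3 (J0⁺): the residual order does not rise -/

/-- **(J0⁺) `d′ ≤ d`, with the budget data.**  For a `q`-fold (`q = p^e`) `V_q`-active `F` and a MODE-0 edge
(`t j = 0`) with non-zero child: the key class monomial `x^D = x^{cls A} x^k` lies in the child, is divisible by
nothing less than `x^ρ`, and `|D| + |r| ≤ o + |ρ|`; consequently `d′ = o′ − |r′| ≤ |D| − |ρ| ≤ o − |r| = d`.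
Returned: such a `D` together with the two order identities, for the equality analysis of Π. [folklore] -/
theorem exists_support_step_budget (p : ℕ) [Fact p.Prime] [CharP K p] (e : ℕ) (s : CState σ K) (j : σ)
    (t : σ → K) (ht : t j = 0) (hq : ((p ^ e : ℕ) : ℕ∞) ≤ ordZero s.F) {A : σ →₀ ℕ} (hA : A ∈ s.F.support)
    (hAdeg : ((A.degree : ℕ) : ℕ∞) = ordZero s.F) {i : σ} (hi : i ∉ s.exc) (hqi : ¬ p ^ e ∣ A i) :
    ∃ o : ℕ, ordZero s.F = o ∧ p ^ e ≤ o ∧ A.degree = o ∧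
      ∃ k ∈ (classPoly (p ^ e) j t s.F (cls (p ^ e) j t A)).support,
        k.degree + (tPart t (exceptionalExp s.exc s.F)).degree + exceptionalExp s.exc s.F j ≤
            (tPart t A).degree + A j ∧
          ¬ IsPthPowerExponent (p ^ e) (cls (p ^ e) j t A + k) ∧
          cls (p ^ e) j t A + k ∈ (CentreBlowup.step (p ^ e) Finset.univ j t s).F.support ∧
          (cls (p ^ e) j t A + k).degree + (exceptionalExp s.exc s.F).degree ≤
            o + (rho (p ^ e) j t (exceptionalExp s.exc s.F) o).degree := by
  set q := p ^ e with hqdef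
  have hF0 : s.F ≠ 0 := MvPolynomial.support_nonempty.mp ⟨A, hA⟩
  obtain ⟨o, ho⟩ := exists_ordZero_eq_natCast hF0
  have hAo : A.degree = o := by rw [ho] at hAdeg; exact_mod_cast hAdeg
  have hqo : q ≤ o := by rw [ho] at hq; exact_mod_cast hq
  have hob : ∀ b ∈ s.F.support, o ≤ b.degree := forall_le_degree_of_ordZero_eq ho le_rfl
  have hr : ∀ b ∈ s.F.support, exceptionalExp s.exc s.F ≤ b :=
    fun b hb => exceptionalExp_le_exponent_of_mem_support s.exc hb
  have hri : exceptionalExp s.exc s.F i = 0 := exceptionalExp_apply_eq_zero_of_not_mem s.F hi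
  obtain ⟨k, hk, hkdeg, hnp⟩ := exists_key p e ht hqo hob hr hA hAo hri hqi
  have hku := uPart_eq_zero_of_mem_support_classPoly q j t s.F hk
  have hD : cls q j t A + k ∈ (CentreBlowup.step q Finset.univ j t s).F.support := by
    rw [MvPolynomial.mem_support_iff, coeff_cls_add_step q ht s A hku, if_neg hnp]
    exact MvPolynomial.mem_support_iff.mp hk
  exact ⟨o, ho, hqo, hAo, k, hk, hkdeg, hnp, hD, degree_budget q ht hqo (hr A hA) hAo hkdeg⟩

/-- **(J0⁺) THE RESIDUAL ORDER DOES NOT RISE** on a MODE-0 edge (`t j = 0`) from a `q`-fold (`q = p^e`)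
`V_q`-active state with non-zero child: `residualOrder Δ′ F′ ≤ residualOrder Δ F` — the first conclusion of
`Plateau.PiEdge`, for every field of characteristic `p` and any number of variables.  OURS (res-dim4-idea-5
CARD I-5-5, pen proof idea-5 / crit-2 / crit-3); kernel-checked here. [folklore] -/
theorem residualOrder_step_le (p : ℕ) [Fact p.Prime] [CharP K p] (e : ℕ) (s : CState σ K) (j : σ)
    (t : σ → K) (ht : t j = 0) (hq : ((p ^ e : ℕ) : ℕ∞) ≤ ordZero s.F) (hV : IsVActive (p ^ e) s.exc s.F)
    (hne : (CentreBlowup.step (p ^ e) Finset.univ j t s).F ≠ 0) :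
    residualOrder (CentreBlowup.step (p ^ e) Finset.univ j t s).exc (CentreBlowup.step (p ^ e) Finset.univ j t s).F ≤
      residualOrder s.exc s.F := by
  obtain ⟨A, hA, hAdeg, i, hiΔ, hqi⟩ := hV
  obtain ⟨o, ho, hqo, hAo, k, -, -, -, hD, hbud⟩ := exists_support_step_budget p e s j t ht hq hA hAdeg hiΔ hqi
  have hob : ∀ b ∈ s.F.support, o ≤ b.degree := forall_le_degree_of_ordZero_eq ho le_rfl
  obtain ⟨hrdeg, hd⟩ := residualOrder_eq_ordZero_sub s.exc ho
  obtain ⟨o', ho'⟩ := exists_ordZero_eq_natCast hne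
  obtain ⟨hr'deg, hd'⟩ := residualOrder_eq_ordZero_sub (CentreBlowup.step (p ^ e) Finset.univ j t s).exc ho'
  have hρ := degree_rho_le_degree_exceptionalExp_step (p ^ e) ht s hob hne
  have ho'D : o' ≤ (cls (p ^ e) j t A + k).degree := by
    have := ordZero_le_degree_of_mem_support hD
    rw [ho'] at this
    exact_mod_cast this
  rw [hd, hd', Nat.cast_le]
  omega

/-- **Equality analysis** (for Π): if moreover `d′ = d`, then the key class monomial is an INITIAL monomial of
the child (`|cls A + k| = ord₀ F′`) and sits exactly at the top of the budget. [folklore] -/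
theorem degree_eq_of_residualOrder_eq (p : ℕ) [Fact p.Prime] [CharP K p] (e : ℕ) (s : CState σ K) (j : σ)
    (t : σ → K) (ht : t j = 0) {o : ℕ} (ho : ordZero s.F = o)
    (hne : (CentreBlowup.step (p ^ e) Finset.univ j t s).F ≠ 0)
    (heq : residualOrder (CentreBlowup.step (p ^ e) Finset.univ j t s).exc
        (CentreBlowup.step (p ^ e) Finset.univ j t s).F = residualOrder s.exc s.F)
    {D : σ →₀ ℕ} (hD : D ∈ (CentreBlowup.step (p ^ e) Finset.univ j t s).F.support)
    (hbud : D.degree + (exceptionalExp s.exc s.F).degree ≤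
      o + (rho (p ^ e) j t (exceptionalExp s.exc s.F) o).degree) :
    ((D.degree : ℕ) : ℕ∞) = ordZero (CentreBlowup.step (p ^ e) Finset.univ j t s).F ∧
      D.degree + (exceptionalExp s.exc s.F).degree = o + (rho (p ^ e) j t (exceptionalExp s.exc s.F) o).degree := by
  have hob : ∀ b ∈ s.F.support, o ≤ b.degree := forall_le_degree_of_ordZero_eq ho le_rfl
  have hr : ∀ b ∈ s.F.support, exceptionalExp s.exc s.F ≤ b :=
    fun b hb => exceptionalExp_le_exponent_of_mem_support s.exc hb
  obtain ⟨hrdeg, hd⟩ := residualOrder_eq_ordZero_sub s.exc ho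
  obtain ⟨o', ho'⟩ := exists_ordZero_eq_natCast hne
  obtain ⟨hr'deg, hd'⟩ := residualOrder_eq_ordZero_sub (CentreBlowup.step (p ^ e) Finset.univ j t s).exc ho'
  have hρ := degree_rho_le_degree_exceptionalExp_step (p ^ e) ht s hob hne
  have hρD : (rho (p ^ e) j t (exceptionalExp s.exc s.F) o).degree ≤ D.degree :=
    Finsupp.degree_mono (rho_le_of_mem_support_step (p ^ e) ht s hr hob hD)
  have ho'D : o' ≤ D.degree := by
    have := ordZero_le_degree_of_mem_support hD
    rw [ho'] at this
    exact_mod_cast this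
  rw [hd, hd', Nat.cast_inj] at heq
  rw [ho']
  constructor
  · exact_mod_cast (show D.degree = o' by omega)
  · omega

end Plateau

end Summit.ResolutionOfSingularities.ResolutionOfSingularities.Theorems.PIDim4
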